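import Summits.CriticalPhenomena.PercolationContinuityZ3.Theorems.PercBurnResprinkleVacantReignitionFreshDominationAux
import Literature.Probability.Percolation.StochasticDominationProofs
import HarnessLib

/-!
# Crux `PercBurnResprinkle.VacantReignition` (stmt-CriticalPhenomena-7203), line `strip-fresh-field-lss`,
# stub `stub_transport` — auxiliary file 2: percolation along a subdivision; laws of dust fields

Pure-theorem helper file (lead prover-line-stmt-CriticalPhenomena-7203-0, worker on `stub_transport`)
for the STAR-DUST BLOCK-REFINEMENT TRANSPORT (`E₁ ⟹ stub_noCagesFat`, see the companion file
`PercBurnResprinkleVacantReignitionTransportAux.lean` for the refinement `y : ℤ³ → ℤ³` and its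
dust slots).  This file holds the two generic ingredients that do not refer to the refinement:

* `vacantReignition_tr_fine_percolates` — the PATHWISE step: if `y : ℤ^d → ℤ^d` is injective,
  `y(0) = 0`, `y(a + eᵢ) = y(a) + n(a,i) eᵢ`, block `0` lies in an infinite nearest-neighbour
  cluster of `P`-blocks, and every point of the straight segment between the images of two
  adjacent `P`-blocks is good, then `0` lies in an infinite nearest-neighbour cluster of good
  points (block edges become good lattice segments, block walks lift, `y` is injective on the
  infinite block cluster) — the deterministic core of every static renormalisation
  (Grimmett 1999, §7.4 p. 181: "an infinite path of good blocks … contains an infinite open path");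
* `vacantReignition_tr_measure_biInter_dust` — DUST CYLINDERS: for an injective family of pairs
  `e i` and `t ∈ [0,1]`, `P(U_{e i} ≤ t ∀ i ∈ S) = t^{|S|}` under the label measure
  `labelMeasure = ⨂_e Leb|[0,1]` (Grimmett 1999, §1.3 p. 11), from
  `vacantReignition_dom_iIndepSet_dust` and `vacantReignition_dom_real_dust`;
* `vacantReignition_tr_law_transfer` — TRANSFER OF LAWS: two families of events with the same
  cylinder probabilities `P(⋂_{i ∈ G} Y_i) = P(⋂_{i ∈ G} X_i)` induce the same law of the random
  set `{i | Y_i}` resp. `{i | X_i}` (π-λ on the events `{s | G ⊆ s}`, `LSS.measure_set_ext` of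
  `Literature/Probability/Percolation/StochasticDominationProofs.lean`), hence every measurable
  functional of the random set intersected with a fixed set has the same probability — used with
  `X` = the slot events of the coarse blocks (`3M` distinct label coordinates each, threshold
  `ρ_k = r^{1/3M}`) and `Y` = the coarse dust events (one coordinate, threshold `r`), both i.i.d.
  Bernoulli(`r`) fields.

No definitions; public names are prefixed `vacantReignition_tr_`.

## References

* G. Grimmett, *Percolation*, 2nd ed., Springer 1999, §1.3 p. 11, §7.4 pp. 178–181
  [GrimmettPercolation1999].
* T. M. Liggett, R. H. Schonmann, A. M. Stacey, *Domination by product measures*, Ann. Probab. 25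
  (1997) 71–95, Lemma 1.1 (laws of random sets via cylinder events) [LiggettSchonmannStacey1997].
-/

noncomputable section

namespace Summit.CriticalPhenomena.PercolationContinuityZ3.Theorems

open MeasureTheory ProbabilityTheory Literature.Probability.Percolation Literature.Probability.LatticeModels
open scoped ENNReal

/-! ### Block percolation along a lattice subdivision -/

/-- Reachability is transported along any vertex map sending edges to joined pairs (induction on a
walk). [folklore] -/
private theorem vacantReignition_tr_reachable_lift {V W : Type*} {G : SimpleGraph V} {H : SimpleGraph W}
    (φ : V → W) {a b : V} (p : G.Walk a b) (h : ∀ a b, G.Adj a b → H.Reachable (φ a) (φ b)) :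
    H.Reachable (φ a) (φ b) := by
  -- adapted from `reachable_lift` (Theorems/VacantReignition/Negative/NoCagesFatNeedsVacantSet.lean)
  induction p with
  | nil => exact SimpleGraph.Reachable.refl _
  | cons hadj _ ih => exact (h _ _ hadj).trans ih

/-- An edge of the block graph is a lattice edge whose endpoints both satisfy the block predicate.
[folklore] -/
private theorem vacantReignition_tr_adj_blockGraph {V : Type*} {E₀ : Set (Sym2 V)} {P : V → Prop} {a b : V}
    (h : (openGraph {E : Sym2 V | E ∈ E₀ ∧ ∀ z ∈ E, P z}).Adj a b) : s(a, b) ∈ E₀ ∧ P a ∧ P b := by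
  -- adapted from `adj_blockGraph` (Theorems/VacantReignition/Negative/NoCagesFatNeedsVacantSet.lean)
  rw [openGraph_adj, Set.mem_setOf_eq] at h
  exact ⟨h.1.1, h.1.2 a (Sym2.mem_mk_left a b), h.1.2 b (Sym2.mem_mk_right a b)⟩

/-- **Straight segments of good vertices are paths of the good-edge graph**: if `c, c + eᵢ, …,
c + n eᵢ` are all good, then `c` and `c + n eᵢ` are joined in the graph of lattice edges with two good
endpoints. [folklore] -/
private theorem vacantReignition_tr_reachable_segment {d : ℕ} (good : (Fin d → ℤ) → Prop) (c : Fin d → ℤ)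
    (i : Fin d) (n : ℕ) (h : ∀ j : ℕ, j ≤ n → good (c + Pi.single i (j : ℤ))) :
    (openGraph {e : Sym2 (Fin d → ℤ) | e ∈ (zdGraph d).edgeSet ∧ ∀ x ∈ e, good x}).Reachable
      c (c + Pi.single i (n : ℤ)) := by
  -- adapted from `reachable_segment` (Theorems/VacantReignition/Negative/NoCagesFatNeedsVacantSet.lean)
  induction n with
  | zero =>
    rw [Nat.cast_zero, Pi.single_zero, add_zero]
  | succ n ih =>
    have hadj : (zdGraph d).Adj (c + Pi.single i (n : ℤ)) (c + Pi.single i ((n + 1 : ℕ) : ℤ)) := by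
      rw [zdGraph_adj_iff]
      refine ⟨i, Or.inl ?_⟩
      rw [add_assoc, ← Pi.single_add]
      push_cast
      rfl
    refine (ih fun j hj => h j (Nat.le_succ_of_le hj)).trans (SimpleGraph.Adj.reachable ?_)
    rw [openGraph_adj]
    refine ⟨⟨(SimpleGraph.mem_edgeSet _).2 hadj, fun x hx => ?_⟩, hadj.ne⟩
    rcases Sym2.mem_iff.1 hx with rfl | rfl
    · exact h n (Nat.le_succ n)
    · exact h (n + 1) le_rfl

/-- **Block percolation along a subdivision** (deterministic).  Let `y : ℤ^d → ℤ^d` be injective with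
`y 0 = 0` and `y(a + eᵢ) = y(a) + n(a,i) eᵢ` (a subdivision of the lattice with straight segments).
If block `0` lies in an infinite nearest-neighbour cluster of `P`-blocks, and for all `P`-blocks
`a ~ a + eᵢ` every point `y(a) + j eᵢ`, `0 ≤ j ≤ n(a,i)`, of the segment between their images is
good, then `0 = y(0)` lies in an infinite nearest-neighbour cluster of good points: block edges
become good segments (`…reachable_segment`), block walks lift (`…reachable_lift`), and `y` is
injective on the infinite block cluster. [folklore] -/
theorem vacantReignition_tr_fine_percolates : ∀ {d : ℕ} (y : (Fin d → ℤ) → (Fin d → ℤ)), y 0 = 0 →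
    Function.Injective y → ∀ (n : (Fin d → ℤ) → Fin d → ℕ),
    (∀ a i, y (a + Pi.single i 1) = y a + Pi.single i (n a i : ℤ)) →
    ∀ (P good : (Fin d → ℤ) → Prop),
    (openCluster {E : Sym2 (Fin d → ℤ) | E ∈ (zdGraph d).edgeSet ∧ ∀ x ∈ E, P x}
      (0 : Fin d → ℤ)).Infinite →
    (∀ a i, P a → P (a + Pi.single i 1) → ∀ j : ℕ, j ≤ n a i → good (y a + Pi.single i (j : ℤ))) →
    (openCluster {e : Sym2 (Fin d → ℤ) | e ∈ (zdGraph d).edgeSet ∧ ∀ x ∈ e, good x}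
      (0 : Fin d → ℤ)).Infinite := by
  intro d y hy0 hinj n hstep P good hperc hgood
  -- adapted from `infinite_openCluster_centres` (Theorems/VacantReignition/Negative/NoCagesFatNeedsVacantSet.lean)
  -- segments between the images of adjacent `P`-blocks
  have hseg : ∀ a i, P a → P (a + Pi.single i 1) →
      (openGraph {e : Sym2 (Fin d → ℤ) | e ∈ (zdGraph d).edgeSet ∧ ∀ x ∈ e, good x}).Reachable
        (y a) (y (a + Pi.single i 1)) := by
    intro a i ha hb
    rw [hstep]
    exact vacantReignition_tr_reachable_segment good (y a) i (n a i) (hgood a i ha hb)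
  -- every block edge glues the two images
  have hadj : ∀ a b, (openGraph {E : Sym2 (Fin d → ℤ) | E ∈ (zdGraph d).edgeSet ∧ ∀ x ∈ E, P x}).Adj a b →
      (openGraph {e : Sym2 (Fin d → ℤ) | e ∈ (zdGraph d).edgeSet ∧ ∀ x ∈ e, good x}).Reachable
        (y a) (y b) := by
    intro a b h
    obtain ⟨hab, hPa, hPb⟩ := vacantReignition_tr_adj_blockGraph h
    rw [SimpleGraph.mem_edgeSet, zdGraph_adj_iff] at hab
    obtain ⟨i, hb | ha'⟩ := hab
    · subst hb; exact hseg a i hPa hPb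
    · subst ha'; exact (hseg b i hPb hPa).symm
  -- hence every image of the block cluster of `0` is joined to `y 0 = 0`
  have hreach : ∀ z ∈ openCluster {E : Sym2 (Fin d → ℤ) | E ∈ (zdGraph d).edgeSet ∧ ∀ x ∈ E, P x}
      (0 : Fin d → ℤ),
      (openGraph {e : Sym2 (Fin d → ℤ) | e ∈ (zdGraph d).edgeSet ∧ ∀ x ∈ e, good x}).Reachable
        (y 0) (y z) := by
    intro z hz
    obtain ⟨W⟩ := (hz : (openGraph _).Reachable 0 z)
    exact vacantReignition_tr_reachable_lift y W hadj
  refine Set.infinite_of_injOn_mapsTo hinj.injOn (fun z hz => ?_) hperc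
  have h := hreach z hz
  rw [hy0] at h
  exact h

/-! ### Measure: dust cylinders and transfer of laws -/

/-- **Dust cylinders.** For an injective family of pairs `e i` and a threshold `t ∈ [0, 1]`,
`P(U_{e i} ≤ t for all i ∈ S) = t ^ |S|` under `labelMeasure` (independence of distinct coordinates,
`vacantReignition_dom_iIndepSet_dust`, and the one-coordinate marginal `vacantReignition_dom_real_dust`).
[folklore] -/
theorem vacantReignition_tr_measure_biInter_dust {ι V : Type*} (e : ι → Sym2 V) (he : Function.Injective e)
    {t : ℝ} (h0 : 0 ≤ t) (h1 : t ≤ 1) (S : Finset ι) :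
    labelMeasure V (⋂ i ∈ S, {U : Sym2 V → ℝ | U (e i) ≤ t}) = ENNReal.ofReal t ^ S.card := by
  have := isProbabilityMeasure_labelMeasure V
  have hind := vacantReignition_dom_iIndepSet_dust e he t
  rw [(iIndepSet_iff_meas_biInter fun i => vacantReignition_dom_measurableSet_dust (e i) t).1 hind S]
  have hfac : ∀ i ∈ S, labelMeasure V {U : Sym2 V → ℝ | U (e i) ≤ t} = ENNReal.ofReal t := fun i _ => by
    rw [← ofReal_measureReal (measure_ne_top _ _), vacantReignition_dom_real_dust (e i) h0 h1]
  rw [Finset.prod_congr rfl hfac, Finset.prod_const]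

/-- **Transfer of laws of random sets.** If two families of measurable events `X i`, `Y i` have the
same cylinder probabilities `P(⋂_{i ∈ G} Y i) = P(⋂_{i ∈ G} X i)` for all finite `G`, then the random
sets `{i | Y i}` and `{i | X i}` have the same law (`LSS.measure_set_ext`, π-λ on the events
`{s | G ⊆ s}`), so every measurable functional `Φ` of the random set intersected with a fixed set `W`
has the same probability. [folklore] -/
theorem vacantReignition_tr_law_transfer {Ω ι : Type*} [MeasurableSpace Ω] [DecidableEq ι]
    (μ : Measure Ω) [IsProbabilityMeasure μ] (Φ : Set ι → Prop) (hΦ : MeasurableSet {S | Φ S})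
    (W : ι → Prop) (X Y : ι → Set Ω) (hX : ∀ i, MeasurableSet (X i)) (hY : ∀ i, MeasurableSet (Y i))
    (h : ∀ G : Finset ι, μ (⋂ i ∈ G, Y i) = μ (⋂ i ∈ G, X i)) :
    μ {b | Φ {i | W i ∧ b ∈ Y i}} = μ {b | Φ {i | W i ∧ b ∈ X i}} := by
  have hS : ∀ Z : ι → Set Ω, (∀ i, MeasurableSet (Z i)) → Measurable fun b : Ω => {i | b ∈ Z i} :=
    fun Z hZ => measurable_set_iff.2 fun i => by
      simp only [Set.mem_setOf_eq]; exact measurable_mem.2 (hZ i)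
  have hE : MeasurableSet {S : Set ι | Φ {i | W i ∧ i ∈ S}} := by
    have hf : Measurable fun S : Set ι => {i | W i ∧ i ∈ S} :=
      measurable_set_iff.2 fun i => by
        simp only [Set.mem_setOf_eq]; exact measurable_const.and (measurable_set_mem i)
    exact hΦ.preimage hf
  have hrepr : ∀ Z : ι → Set Ω, {b | Φ {i | W i ∧ b ∈ Z i}} =
      (fun b : Ω => {i | b ∈ Z i}) ⁻¹' {S : Set ι | Φ {i | W i ∧ i ∈ S}} := fun Z => rfl
  have : IsProbabilityMeasure (μ.map fun b => {i | b ∈ Y i}) :=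
    Measure.isProbabilityMeasure_map (hS Y hY).aemeasurable
  have : IsProbabilityMeasure (μ.map fun b => {i | b ∈ X i}) :=
    Measure.isProbabilityMeasure_map (hS X hX).aemeasurable
  have hlaw : μ.map (fun b => {i | b ∈ Y i}) = μ.map (fun b => {i | b ∈ X i}) := by
    refine LSS.measure_set_ext fun G => ?_
    have hGm : MeasurableSet {s : Set ι | ↑G ⊆ s} := LSS.measurableSet_supsets ⟨G, rfl⟩
    rw [Measure.map_apply (hS Y hY) hGm, Measure.map_apply (hS X hX) hGm]
    have h1 : ∀ Z : ι → Set Ω, (fun b : Ω => {i | b ∈ Z i}) ⁻¹' {s : Set ι | ↑G ⊆ s} = ⋂ i ∈ G, Z i := by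
      intro Z; ext b; simp [Set.subset_def]
    rw [h1, h1, h G]
  rw [hrepr Y, hrepr X, ← Measure.map_apply (hS Y hY) hE, ← Measure.map_apply (hS X hX) hE, hlaw]

end Summit.CriticalPhenomena.PercolationContinuityZ3.Theorems

end
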